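import Mathlib
import HarnessLib

/-!
# Tools stub `stub_witnessBumpTools` of line Sketch (crux stmt-AnomalousDissipation-18401,
  `TameRoughRigidity.TameToRough`): wide even bumps with small gradient

**Tools B.** For every dimension `m` (including `m = 0`), radius `ρ > 0` and tolerance `ε > 0`
there is a `C¹`, compactly supported, even `χ : ℝᵐ → [0, 1]` (`ℝᵐ = EuclideanSpace ℝ (Fin m)`)
with `χ = 1` on the closed ball `‖c‖ ≤ ρ`, `Dχ = 0` on the open ball `‖c‖ < ρ`, and all
coordinate derivatives bounded by `ε` everywhere: `|Dχ(c) eᵢ| ≤ ε`.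

Proof. Take the Mathlib bump `g : ContDiffBump (0 : ℝᵐ)` with radii `1 < 2`; it is smooth,
compactly supported, even (`ContDiffBump.neg`), valued in `[0, 1]` and `= 1` on the closed unit
ball. Its derivative is continuous with compact support, hence `‖Dg‖ ≤ M` for some `M`
(`witnessBump_fderiv_bound`). RESCALE: `χ c := g (L⁻¹ • c)` with `L := max ρ (M / ε)`. Then
`χ = 1` for `‖c‖ ≤ ρ ≤ L`; `Dχ = 0` on the open ball because `χ` is locally the constant `1`
there (`Filter.EventuallyEq.fderiv_eq`); and `Dχ(c) = L⁻¹ • Dg(L⁻¹ • c)` (`fderiv_comp_smul`), so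
`|Dχ(c) eᵢ| ≤ L⁻¹ ‖Dg(L⁻¹ • c)‖ ‖eᵢ‖ ≤ L⁻¹ M ≤ ε`.

Mathlib search: `ContDiffBump` (`contDiff`, `hasCompactSupport`, `neg`, `nonneg`, `le_one`,
`one_of_mem_closedBall`), `HasCompactSupport.fderiv`, `ContDiff.continuous_fderiv`,
`Continuous.bounded_above_of_compact_support`, `HasCompactSupport.comp_smul`, `fderiv_comp_smul`,
`ContinuousLinearMap.le_opNorm`, `PiLp.norm_single`. Tree: the same bound-by-compact-support
pattern is `Literature.Analysis.Calculus.exists_lipschitz_bound_bump` (re-derived here in four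
lines to keep the imports to Mathlib).
-/

set_option linter.dupNamespace false

noncomputable section

namespace Summit.AnomalousDissipation.AnomalousDissipation.Theorems.TameRoughRigidity.TameToRough

open MeasureTheory Filter Topology
open scoped InnerProductSpace RealInnerProductSpace ENNReal NNReal

/-- **A smooth bump has a globally bounded derivative**: for a `ContDiffBump` `g` on a
finite-dimensional space there is `M` with `‖Dg(y)‖ ≤ M` for all `y` (the derivative is
continuous with compact support). [folklore] -/
theorem witnessBump_fderiv_bound {E : Type*} [NormedAddCommGroup E] [NormedSpace ℝ E]
    [HasContDiffBump E] [FiniteDimensional ℝ E] {c : E} (g : ContDiffBump c) :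
    ∃ M : ℝ, ∀ y, ‖fderiv ℝ (g : E → ℝ) y‖ ≤ M := by
  have hcs : HasCompactSupport (fderiv ℝ (g : E → ℝ)) := g.hasCompactSupport.fderiv ℝ
  have hcont : Continuous (fderiv ℝ (g : E → ℝ)) :=
    (g.contDiff (n := 1)).continuous_fderiv one_ne_zero
  exact hcont.bounded_above_of_compact_support hcs

/-- **Rescaled bumps**: if `g : ContDiffBump 0` has inner radius `1` and `‖Dg‖ ≤ M` everywhere,
then for `L > 0` the rescaled bump `c ↦ g (L⁻¹ • c)` is `C¹`, compactly supported, even, valued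
in `[0, 1]`, equal to `1` on the closed ball of radius `L`, has zero derivative on the open ball
of radius `L`, and satisfies `|D(g (L⁻¹ • ·))(c) e| ≤ L⁻¹ * M * ‖e‖`. [folklore] -/
theorem witnessBump_rescale {E : Type*} [NormedAddCommGroup E] [NormedSpace ℝ E]
    [HasContDiffBump E] [FiniteDimensional ℝ E] (g : ContDiffBump (0 : E)) (hgIn : g.rIn = 1)
    {M : ℝ} (hM : ∀ y, ‖fderiv ℝ (g : E → ℝ) y‖ ≤ M) {L : ℝ} (hL : 0 < L) :
    ContDiff ℝ 1 (fun c => g (L⁻¹ • c)) ∧ HasCompactSupport (fun c => g (L⁻¹ • c)) ∧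
      (∀ c, g (L⁻¹ • (-c)) = g (L⁻¹ • c)) ∧ (∀ c, 0 ≤ g (L⁻¹ • c) ∧ g (L⁻¹ • c) ≤ 1) ∧
      (∀ c, ‖c‖ ≤ L → g (L⁻¹ • c) = 1) ∧
      (∀ c, ‖c‖ < L → fderiv ℝ (fun c => g (L⁻¹ • c)) c = 0) ∧
      (∀ c e, |fderiv ℝ (fun c => g (L⁻¹ • c)) c e| ≤ L⁻¹ * M * ‖e‖) := by
  have hone : ∀ c : E, ‖c‖ ≤ L → g (L⁻¹ • c) = 1 := by
    intro c hc
    apply g.one_of_mem_closedBall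
    rw [mem_closedBall_zero_iff, hgIn, norm_smul, norm_inv, Real.norm_of_nonneg hL.le,
      inv_mul_le_iff₀ hL, mul_one]
    exact hc
  refine ⟨(g.contDiff (n := 1)).comp (contDiff_const_smul L⁻¹),
    g.hasCompactSupport.comp_smul (inv_ne_zero hL.ne'), fun c => ?_,
    fun c => ⟨g.nonneg, g.le_one⟩, hone, fun c hc => ?_, fun c e => ?_⟩
  · rw [smul_neg]
    exact g.neg _
  · have hev : (fun x => g (L⁻¹ • x)) =ᶠ[𝓝 c] fun _ => (1 : ℝ) := by
      filter_upwards [Metric.isOpen_ball.mem_nhds (mem_ball_zero_iff.2 hc)] with x hx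
      exact hone x (le_of_lt (mem_ball_zero_iff.1 hx))
    rw [hev.fderiv_eq]
    exact fderiv_const_apply _
  · rw [fderiv_comp_smul, _root_.smul_apply, smul_eq_mul, abs_mul, abs_inv, abs_of_pos hL,
      mul_assoc]
    refine mul_le_mul_of_nonneg_left ?_ (inv_nonneg.2 hL.le)
    calc |fderiv ℝ (g : E → ℝ) (L⁻¹ • c) e|
        ≤ ‖fderiv ℝ (g : E → ℝ) (L⁻¹ • c)‖ * ‖e‖ := by
          rw [← Real.norm_eq_abs]
          exact ContinuousLinearMap.le_opNorm _ _
      _ ≤ M * ‖e‖ := mul_le_mul_of_nonneg_right (hM _) (norm_nonneg _)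

/-- **Tools B `stub_witnessBumpTools`.** Wide even bumps with small gradient: for every `m`,
radius `ρ > 0` and `ε > 0` there is a `C¹`, compactly supported, even `χ : ℝᵐ → [0,1]` with
`χ = 1` on the closed ball of radius `ρ`, `Dχ = 0` on the open ball, and all partial derivatives
bounded by `ε` everywhere (rescale the even Mathlib `ContDiffBump` centred at `0` by
`L := max ρ (M / ε)`, `M` a bound of its gradient). [folklore] -/
theorem stub_witnessBumpTools :
    ∀ (m : ℕ) (ρ ε : ℝ), 0 < ρ → 0 < ε →
      ∃ χ : EuclideanSpace ℝ (Fin m) → ℝ, ContDiff ℝ 1 χ ∧ HasCompactSupport χ ∧ (∀ c, χ (-c) = χ c) ∧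
        (∀ c, 0 ≤ χ c ∧ χ c ≤ 1) ∧ (∀ c, ‖c‖ ≤ ρ → χ c = 1) ∧ (∀ c, ‖c‖ < ρ → fderiv ℝ χ c = 0) ∧
        (∀ c i, |fderiv ℝ χ c (EuclideanSpace.single i 1)| ≤ ε) := by
  intro m ρ ε hρ hε
  obtain ⟨g, hgIn⟩ : ∃ g : ContDiffBump (0 : EuclideanSpace ℝ (Fin m)), g.rIn = 1 :=
    ⟨⟨1, 2, one_pos, one_lt_two⟩, rfl⟩
  obtain ⟨M, hM⟩ := witnessBump_fderiv_bound g
  set L : ℝ := max ρ (M / ε) with hL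
  have hLpos : 0 < L := lt_max_of_lt_left hρ
  have hρL : ρ ≤ L := le_max_left _ _
  have hML : M / ε ≤ L := le_max_right _ _
  obtain ⟨h1, h2, h3, h4, h5, h6, h7⟩ := witnessBump_rescale g hgIn hM hLpos
  refine ⟨fun c => g (L⁻¹ • c), h1, h2, h3, h4, fun c hc => h5 c (hc.trans hρL),
    fun c hc => h6 c (hc.trans_le hρL), fun c i => ?_⟩
  calc |fderiv ℝ (fun c => g (L⁻¹ • c)) c (EuclideanSpace.single i 1)|
      ≤ L⁻¹ * M * ‖EuclideanSpace.single i (1 : ℝ)‖ := h7 c _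
    _ = L⁻¹ * M := by simp
    _ ≤ ε := by
        rw [inv_mul_le_iff₀ hLpos]
        exact (div_le_iff₀ hε).1 hML

end Summit.AnomalousDissipation.AnomalousDissipation.Theorems.TameRoughRigidity.TameToRough

end
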